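import Literature.MathematicalPhysics.QuantumFieldTheory.CentralTwistLocality
import HarnessLib

/-!
# The strong-coupling vortex bound for every compact gauge group with a central involution, and Ito–Seiler 2008
# Theorem 2.2 (1) for `G = U(1)` (and every Wilson-type action) on symmetric tori

Topic `Literature/MathematicalPhysics/QuantumFieldTheory`; vocabulary of `CentralTwistPolymers.lean` (namespace `CentralTwist`:
`twistZ d L z w V`, `twistPolymerActivity`), `TwistedPartitionFunction.lean` (`twistedPartitionFunction ρ β L z q`, 't Hooft's
twisted partition function of Wilson's action for a representation `ρ : G →* Matrix (Fin N) (Fin N) ℂ`),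
`QuantumLattice/GaugeGroups.lean` (`u1Rep : Circle →* Matrix (Fin 1) (Fin 1) ℂ`, `U(1) = Circle`) and the Kotecký–Preiss layer
`Literature.Probability.LatticeModels.{ClusterExpansion, ClusterExpansionKPBound, AnchoredClusterExpansion}`. THEOREMS ONLY
(no definition, no fact).

K. R. Ito, E. Seiler, arXiv:0803.3019 [ItoSeiler2008Further] §2 Theorem 2.2: "Define `F = 1 - Z⁻_Λ/Z_Λ`. (1) Let `G = U(1)` or
`G = SU(2)`. Then there is a `β₁ > 0` such that for `β < β₁`, `lim_{L₃L₄→∞} (1/L₃L₄) F ≤ const exp[-σ L₁L₂]` (area decay law)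
… (1) is a standard result of the convergent high-temperature expansion (see for instance [Seiler LNP 159])", with Remark 2.1
(3): "The center of `G = U(1)` is again `U(1)`. Then we consider `U(p) = exp(iθ_p)` and `U_ω(p) = exp(i(θ_p + ω))` for
`p ∈ 𝒱`. `U_ω(p) = -U(p)` for `ω = π`."  The `SU(2)` half is `Tomboulis2007.mainClaimTHooft_of_abs_le`
(`PlaquetteWeightVortexBound.lean`); this file proves the bound for EVERY second-countable compact group `G`, central `z` with
`z² = 1` and measurable weight near `1` (`one_sub_twistZ_div_le`), specialises it to Wilson-type actions
`β Σ_p (N - Re tr ρ(U_p))` of a continuous representation (`one_sub_twistedPartitionFunction_div_le`, threshold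
`|β| ≤ 1/(4N (8(d-1)+1)² e²)`), and obtains the `U(1)` half (`u1_one_sub_twistedPartitionFunction_div_le`, `z = -1`,
`|β| ≤ 1/(4 (8(d-1)+1)² e²)`): on every torus `(ℤ/Lℤ)^d` and plane, `1 - Z⁻_{β,L}/Z_{β,L} ≤ 2d² L^{d-2} e^{-L²/2}`.

* `polymerLogZ_sub_polymerLogZ_vortexSheet_eq_twist` — T07 (6.10): `ln Ξ(z) - ln Ξ(z⁻)` is the sum over clusters containing a
  polymer with `≥ L²` plaquettes; `sum_norm_truncatedWeight_le_of_large_twist` — their total is `≤ #plaquettes · e^{-L²}`;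
* `one_sub_twistZ_div_le_card_mul_exp`, `one_sub_twistZ_div_le` — the vortex bound;
* `abs_exp_mul_re_trace_sub_one_le`, `twistedPartitionFunction_eq_twistZ`, `twistedPartitionFunction_div_eq_twistZ_div` — the
  Wilson bridge for any continuous `ρ`; `one_sub_twistedPartitionFunction_div_le`; `u1_one_sub_twistedPartitionFunction_div_le`.

HONEST FRAMING: symmetric tori `(ℤ/Lℤ)^d` (TODO(general form): the printed `L₃L₄ → ∞` at fixed `L₁L₂`); strong coupling
only; part (2) of IS08 Thm 2.2 (deconfinement of `U(1)` at large `β`, Guth / Fröhlich–Spencer) is not touched.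
-/

noncomputable section

open MeasureTheory Finset
open scoped BigOperators
open Literature.MathematicalPhysics.QuantumLattice
open Literature.Probability.LatticeModels (IsRConnected GeomInc Touches)

namespace Literature.MathematicalPhysics.QuantumFieldTheory

namespace CentralTwist

open Tomboulis2007

variable {d L : ℕ} {G : Type*} [Group G]

/-! ## Generic group and weight — the vortex free-energy bound; Wilson-type actions at strong coupling -/

section TwistVortexBound

variable [TopologicalSpace G] [IsTopologicalGroup G] [CompactSpace G] [MeasurableSpace G] [BorelSpace G]
  [SecondCountableTopology G] [NeZero L]

open Literature.Probability.LatticeModels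

omit [TopologicalSpace G] [IsTopologicalGroup G] [CompactSpace G] [MeasurableSpace G] [BorelSpace G]
  [SecondCountableTopology G] [NeZero L] in
/-- Covering bound (plumbing). [folklore] -/
private theorem sum_le_sum_sum_of_cover' {ι κ : Type*} [DecidableEq ι] (𝒞 : Finset ι) (P : Finset κ)
    (S : κ → Finset ι) {g : ι → ℝ} (hg : ∀ C, 0 ≤ g C) (hcover : ∀ C ∈ 𝒞, ∃ p ∈ P, C ∈ S p) :
    ∑ C ∈ 𝒞, g C ≤ ∑ p ∈ P, ∑ C ∈ S p, g C := by
  classical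
  calc ∑ C ∈ 𝒞, g C ≤ ∑ C ∈ 𝒞, ∑ p ∈ P with C ∈ S p, g C := by
        refine Finset.sum_le_sum fun C hC => ?_
        obtain ⟨p, hp, hR⟩ := hcover C hC
        rw [Finset.sum_const, nsmul_eq_mul]
        have h1 : (1 : ℝ) ≤ (P.filter fun p => C ∈ S p).card := by
          exact_mod_cast Finset.card_pos.2 ⟨p, Finset.mem_filter.2 ⟨hp, hR⟩⟩
        nlinarith [hg C]
    _ = ∑ p ∈ P, ∑ C ∈ 𝒞 with C ∈ S p, g C := by
        rw [Finset.sum_comm' (t' := P) (s' := fun p => 𝒞.filter fun C => C ∈ S p)]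
        intro C p
        simp only [Finset.mem_filter]
        tauto
    _ ≤ ∑ p ∈ P, ∑ C ∈ S p, g C := Finset.sum_le_sum fun p _ =>
        Finset.sum_le_sum_of_subset_of_nonneg (fun C hC => (Finset.mem_filter.1 hC).2) fun C _ _ => hg C

/-- **(6.10) for a weight on a compact group**: the Kotecký–Preiss logarithms of `Z⁻` and `Z` differ only by the truncated
functionals of clusters containing a polymer with at least `L²` plaquettes. [cite: Tomboulis2007Confinement, §6.2 eq. (6.10)] -/
theorem polymerLogZ_sub_polymerLogZ_vortexSheet_eq_twist {z : G} (hzc : ∀ g : G, z * g = g * z) (hz2 : z * z = 1)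
    {w : G → ℝ} (hw : Measurable w) {ε : ℝ} (hε : ∀ W, |w W - 1| ≤ ε) {i j : Fin d} (hij : i < j) :
    polymerLogZ (GeomInc linkRel) (twistPolymerActivity z w ∅) (torusPolymers d L) -
        polymerLogZ (GeomInc linkRel) (twistPolymerActivity z w (vortexSheet L i j hij)) (torusPolymers d L) =
      ∑ C ∈ (torusPolymers d L).powerset with
          (C ∩ (torusPolymers d L).filter fun X => L ^ 2 ≤ X.card).Nonempty,
        (truncatedWeight (GeomInc linkRel) (twistPolymerActivity z w ∅) C -
          truncatedWeight (GeomInc linkRel) (twistPolymerActivity z w (vortexSheet L i j hij)) C) := by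
  refine polymerLogZ_sub_eq_sum_filter _ _ fun γ hγ hγT => ?_
  have hlt : γ.card < L ^ 2 := by
    by_contra h
    exact hγT (Finset.mem_filter.2 ⟨hγ, not_lt.1 h⟩)
  exact (twistPolymerActivity_vortexSheet_eq_of_card_lt hzc hz2 hw hε hij hlt).symm

omit [SecondCountableTopology G] in
/-- The tail estimate for a family of clusters each containing a polymer with `≥ L²` plaquettes (any group and twist).
[cite: KoteckyPreiss1986, Theorem p. 492, estimate (4)] -/
theorem sum_norm_truncatedWeight_le_of_large_twist (z : G) {w : G → ℝ} {ε : ℝ} (hε : ∀ W, |w W - 1| ≤ ε)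
    (hsmall : (((8 * (d - 1) : ℕ) : ℝ) + 1) ^ 2 * (Real.exp 2 * ε) ≤ 1 / 2)
    (V : Finset (Plaquette d L)) (𝒞 : Finset (Finset (Finset (Plaquette d L))))
    (hlarge : ∀ C ∈ 𝒞, ∃ X ∈ C, X ∈ torusPolymers d L ∧ L ^ 2 ≤ X.card) :
    ∑ C ∈ 𝒞, ‖truncatedWeight (GeomInc linkRel) (twistPolymerActivity z w V) C‖ ≤
      (Fintype.card (Plaquette d L) : ℝ) * Real.exp (-((L : ℝ) ^ 2)) := by
  classical
  haveI : Std.Refl (GeomInc (linkRel (d := d) (L := L))) := ⟨geomInc_refl _⟩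
  haveI : Std.Symm (GeomInc (linkRel (d := d) (L := L))) := ⟨fun _ _ h => geomInc_symm _ linkRel_symm h⟩
  have hfact := koteckyPreiss_truncatedWeight_bound_holds (GeomInc linkRel) (twistPolymerActivity z w V)
    (fun X : Finset (Plaquette d L) => (X.card : ℝ)) (fun X : Finset (Plaquette d L) => (X.card : ℝ))
  have h1 := kp_hypothesis_twistPolymerActivity_tsum z hε hsmall V
  have hsize : ∀ C ∈ 𝒞, ((L : ℝ) ^ 2) ≤ ∑ γ' ∈ C, ((γ'.card : ℕ) : ℝ) := by
    intro C hC
    obtain ⟨X, hXC, -, hXL⟩ := hlarge C hC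
    have h := Finset.single_le_sum (f := fun γ' : Finset (Plaquette d L) => ((γ'.card : ℕ) : ℝ))
      (fun γ' _ => Nat.cast_nonneg _) hXC
    exact le_trans (by exact_mod_cast hXL) h
  have hstep := fun p : Plaquette d L => sum_norm_truncatedWeight_le_exp_neg_of_touches hfact
    (fun _ => Nat.cast_nonneg _) (fun _ => Nat.cast_nonneg _) h1 𝒞 {p} (r := (L : ℝ) ^ 2)
    (fun C hC _ => hsize C hC)
  have hsum := Finset.sum_le_sum fun p (_ : p ∈ (Finset.univ : Finset (Plaquette d L))) => hstep p
  refine ((sum_le_sum_sum_of_cover' 𝒞 Finset.univ _ (fun C => norm_nonneg _) ?_).trans hsum).trans (le_of_eq ?_)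
  · intro C hC
    obtain ⟨X, hXC, hXP, -⟩ := hlarge C hC
    obtain ⟨p, hp⟩ := nonempty_of_mem_torusPolymers hXP
    exact ⟨p, Finset.mem_univ _, Finset.mem_filter.2
      ⟨hC, X, hXC, Or.inr ⟨p, hp, p, Finset.mem_singleton_self p, Or.inl rfl⟩⟩⟩
  · simp only [Finset.card_singleton, Nat.cast_one, mul_one, Finset.sum_const, Finset.card_univ, nsmul_eq_mul]

/-- **The vortex free-energy bound, raw form** (any second-countable compact group, central involution `z`, measurable
weight): `1 - Z^{(𝒱)}_w/Z_w ≤ 2 · #plaquettes · e^{-L²}` inside the explicit Kotecký–Preiss region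
`(8(d-1)+1)² e² sup|w - 1| ≤ 1/2`, on every symmetric torus, for every plane.
[cite: Tomboulis2007Confinement, §6.2 eqs. (6.10)–(6.12)] [cite: ItoSeiler2008Further, §2 Thm 2.2 (1)] -/
theorem one_sub_twistZ_div_le_card_mul_exp {z : G} (hzc : ∀ g : G, z * g = g * z) (hz2 : z * z = 1)
    {w : G → ℝ} (hw : Measurable w) {ε : ℝ} (hε : ∀ W, |w W - 1| ≤ ε)
    (hsmall : (((8 * (d - 1) : ℕ) : ℝ) + 1) ^ 2 * (Real.exp 2 * ε) ≤ 1 / 2) {i j : Fin d} (hij : i < j) :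
    1 - twistZ d L z w (vortexSheet L i j hij) / twistZ d L z w ∅ ≤
      2 * (Fintype.card (Plaquette d L) : ℝ) * Real.exp (-((L : ℝ) ^ 2)) := by
  have h1 := eps_lt_one_of_kpSmall (d := d) hε hsmall
  have hZ := twistZ_pos (d := d) (L := L) z hw hε h1 ∅
  have hZtw := twistZ_pos (d := d) (L := L) z hw hε h1 (vortexSheet L i j hij)
  have hratio : 0 < twistZ d L z w (vortexSheet L i j hij) / twistZ d L z w ∅ := div_pos hZtw hZ
  set ℓ₀ := polymerLogZ (GeomInc linkRel) (twistPolymerActivity z w ∅) (torusPolymers d L) with hℓ₀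
  set ℓ₁ := polymerLogZ (GeomInc linkRel) (twistPolymerActivity z w (vortexSheet L i j hij)) (torusPolymers d L)
    with hℓ₁
  have hlogZ : Real.log (twistZ d L z w ∅) = ℓ₀.re := log_twistZ_eq_re_polymerLogZ z hw hε hsmall ∅
  have hlogZtw : Real.log (twistZ d L z w (vortexSheet L i j hij)) = ℓ₁.re :=
    log_twistZ_eq_re_polymerLogZ z hw hε hsmall _
  calc 1 - twistZ d L z w (vortexSheet L i j hij) / twistZ d L z w ∅
      ≤ -Real.log (twistZ d L z w (vortexSheet L i j hij) / twistZ d L z w ∅) := by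
        linarith [Real.log_le_sub_one_of_pos hratio]
    _ = Real.log (twistZ d L z w ∅) - Real.log (twistZ d L z w (vortexSheet L i j hij)) := by
        rw [Real.log_div hZtw.ne' hZ.ne']
        ring
    _ = (ℓ₀ - ℓ₁).re := by rw [Complex.sub_re, hlogZ, hlogZtw]
    _ ≤ ‖ℓ₀ - ℓ₁‖ := Complex.re_le_norm _
    _ = ‖∑ C ∈ (torusPolymers d L).powerset with
            (C ∩ (torusPolymers d L).filter fun X => L ^ 2 ≤ X.card).Nonempty,
          (truncatedWeight (GeomInc linkRel) (twistPolymerActivity z w ∅) C -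
            truncatedWeight (GeomInc linkRel) (twistPolymerActivity z w (vortexSheet L i j hij)) C)‖ := by
        rw [hℓ₀, hℓ₁, polymerLogZ_sub_polymerLogZ_vortexSheet_eq_twist hzc hz2 hw hε hij]
    _ ≤ ∑ C ∈ (torusPolymers d L).powerset with
            (C ∩ (torusPolymers d L).filter fun X => L ^ 2 ≤ X.card).Nonempty,
          (‖truncatedWeight (GeomInc linkRel) (twistPolymerActivity z w ∅) C‖ +
            ‖truncatedWeight (GeomInc linkRel) (twistPolymerActivity z w (vortexSheet L i j hij)) C‖) :=
        (norm_sum_le _ _).trans (Finset.sum_le_sum fun C _ => norm_sub_le _ _)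
    _ ≤ (Fintype.card (Plaquette d L) : ℝ) * Real.exp (-((L : ℝ) ^ 2)) +
          (Fintype.card (Plaquette d L) : ℝ) * Real.exp (-((L : ℝ) ^ 2)) := by
        rw [Finset.sum_add_distrib]
        have hl : ∀ C ∈ (torusPolymers d L).powerset.filter (fun C =>
            (C ∩ (torusPolymers d L).filter fun X => L ^ 2 ≤ X.card).Nonempty),
            ∃ X ∈ C, X ∈ torusPolymers d L ∧ L ^ 2 ≤ X.card := by
          intro C hC
          obtain ⟨X, hX⟩ := (Finset.mem_filter.1 hC).2
          rw [Finset.mem_inter, Finset.mem_filter] at hX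
          exact ⟨X, hX.1, hX.2.1, hX.2.2⟩
        exact add_le_add (sum_norm_truncatedWeight_le_of_large_twist z hε hsmall ∅ _ hl)
          (sum_norm_truncatedWeight_le_of_large_twist z hε hsmall (vortexSheet L i j hij) _ hl)
    _ = 2 * (Fintype.card (Plaquette d L) : ℝ) * Real.exp (-((L : ℝ) ^ 2)) := by ring

omit [TopologicalSpace G] [IsTopologicalGroup G] [CompactSpace G] [MeasurableSpace G] [BorelSpace G]
  [SecondCountableTopology G] in
/-- `#plaquettes ≤ d² L^d` (plumbing). [folklore] -/
private theorem card_plaquette_le' : (Fintype.card (Plaquette d L) : ℝ) ≤ (d : ℝ) ^ 2 * (L : ℝ) ^ d := by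
  classical
  have h : Fintype.card (Plaquette d L) ≤ d ^ 2 * L ^ d := by
    rw [Fintype.card_prod]
    have hS : Fintype.card (Site d L) = L ^ d := by
      rw [Fintype.card_pi, Finset.prod_const, ZMod.card, Finset.card_univ, Fintype.card_fin]
    have hP : Fintype.card {p : Fin d × Fin d // p.1 < p.2} ≤ d ^ 2 := by
      refine (Fintype.card_subtype_le _).trans ?_
      rw [Fintype.card_prod, Fintype.card_fin, sq]
    rw [hS, mul_comm]
    exact Nat.mul_le_mul_right _ hP
  exact_mod_cast h

omit [TopologicalSpace G] [IsTopologicalGroup G] [CompactSpace G] [MeasurableSpace G] [BorelSpace G]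
  [SecondCountableTopology G] [NeZero L] in
/-- `x ≤ e^{x/2}` for `x ≥ 0` (plumbing). [folklore] -/
private theorem le_exp_half' {x : ℝ} (hx : 0 ≤ x) : x ≤ Real.exp (x / 2) := by
  have h := Real.add_one_le_exp (x / 4)
  have h2 : Real.exp (x / 2) = Real.exp (x / 4) ^ 2 := by
    rw [← Real.exp_nat_mul]; ring_nf
  rw [h2]
  nlinarith [sq_nonneg (1 - x / 4), Real.exp_pos (x / 4)]

omit [TopologicalSpace G] [IsTopologicalGroup G] [CompactSpace G] [MeasurableSpace G] [BorelSpace G]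
  [SecondCountableTopology G] [NeZero L] in
/-- `L^d e^{-L²} ≤ L^{d-2} e^{-L²/2}` for `d ≥ 2` (plumbing). [folklore] -/
private theorem pow_mul_exp_neg_sq_le' (hd : 2 ≤ d) (L : ℕ) :
    (L : ℝ) ^ d * Real.exp (-((L : ℝ) ^ 2)) ≤ (L : ℝ) ^ (d - 2) * Real.exp (-(1 / 2 * (L : ℝ) ^ 2)) := by
  have hL2 : (0 : ℝ) ≤ (L : ℝ) ^ 2 := by positivity
  have hx := le_exp_half' hL2
  have hsplit : (L : ℝ) ^ d = (L : ℝ) ^ (d - 2) * (L : ℝ) ^ 2 := by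
    rw [← pow_add, Nat.sub_add_cancel hd]
  have hexp : Real.exp (-((L : ℝ) ^ 2)) = Real.exp (-(1 / 2 * (L : ℝ) ^ 2)) * Real.exp (-((L : ℝ) ^ 2 / 2)) := by
    rw [← Real.exp_add]; ring_nf
  rw [hsplit, hexp]
  have hkey : (L : ℝ) ^ 2 * Real.exp (-((L : ℝ) ^ 2 / 2)) ≤ 1 := by
    rw [Real.exp_neg]
    have hpos := Real.exp_pos ((L : ℝ) ^ 2 / 2)
    rw [mul_inv_le_iff₀ hpos, one_mul]
    exact hx
  have hnn : 0 ≤ (L : ℝ) ^ (d - 2) * Real.exp (-(1 / 2 * (L : ℝ) ^ 2)) := by positivity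
  calc (L : ℝ) ^ (d - 2) * (L : ℝ) ^ 2 * (Real.exp (-(1 / 2 * (L : ℝ) ^ 2)) * Real.exp (-((L : ℝ) ^ 2 / 2)))
      = ((L : ℝ) ^ (d - 2) * Real.exp (-(1 / 2 * (L : ℝ) ^ 2))) * ((L : ℝ) ^ 2 * Real.exp (-((L : ℝ) ^ 2 / 2))) := by
        ring
    _ ≤ ((L : ℝ) ^ (d - 2) * Real.exp (-(1 / 2 * (L : ℝ) ^ 2))) * 1 := mul_le_mul_of_nonneg_left hkey hnn
    _ = (L : ℝ) ^ (d - 2) * Real.exp (-(1 / 2 * (L : ℝ) ^ 2)) := mul_one _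

/-- **The strong-coupling vortex bound for every compact gauge group with a central involution and every plaquette weight
near `1`** (second-countable compact `G`, `z` central with `z² = 1`, measurable `w : G → ℝ` with
`(8(d-1)+1)² e² sup|w - 1| ≤ 1/2`): on every symmetric torus `(ℤ/Lℤ)^d` and every plane,
`1 - Z^{(𝒱)}_w/Z_w ≤ 2 d² L^{d-2} e^{-L²/2}` — the 't Hooft electric-flux area-law inequality with `σ = 1/2`, `C = 2d²`
(arXiv:0707.2179 §6.2; IS08 Thm 2.2 (1) "`G = U(1)` or `G = SU(2)`"; Osterwalder–Seiler 1978 §3).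
[cite: Tomboulis2007Confinement, §6.2 eqs. (6.10)–(6.14)] [cite: ItoSeiler2008Further, §2 Thm 2.2 (1)] -/
theorem one_sub_twistZ_div_le {z : G} (hzc : ∀ g : G, z * g = g * z) (hz2 : z * z = 1)
    {w : G → ℝ} (hw : Measurable w) {ε : ℝ} (hε : ∀ W, |w W - 1| ≤ ε)
    (hsmall : (((8 * (d - 1) : ℕ) : ℝ) + 1) ^ 2 * (Real.exp 2 * ε) ≤ 1 / 2) {i j : Fin d} (hij : i < j) :
    1 - twistZ d L z w (vortexSheet L i j hij) / twistZ d L z w ∅ ≤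
      2 * (d : ℝ) ^ 2 * (L : ℝ) ^ (d - 2) * Real.exp (-(1 / 2 * (L : ℝ) ^ 2)) := by
  have hd : 2 ≤ d := by
    have hi := i.isLt
    have hj := j.isLt
    have : (i : ℕ) < j := hij
    omega
  calc 1 - twistZ d L z w (vortexSheet L i j hij) / twistZ d L z w ∅
      ≤ 2 * (Fintype.card (Plaquette d L) : ℝ) * Real.exp (-((L : ℝ) ^ 2)) :=
        one_sub_twistZ_div_le_card_mul_exp hzc hz2 hw hε hsmall hij
    _ ≤ 2 * ((d : ℝ) ^ 2 * (L : ℝ) ^ d) * Real.exp (-((L : ℝ) ^ 2)) :=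
        mul_le_mul_of_nonneg_right (mul_le_mul_of_nonneg_left card_plaquette_le' (by norm_num))
          (Real.exp_nonneg _)
    _ = 2 * (d : ℝ) ^ 2 * ((L : ℝ) ^ d * Real.exp (-((L : ℝ) ^ 2))) := by ring
    _ ≤ 2 * (d : ℝ) ^ 2 * ((L : ℝ) ^ (d - 2) * Real.exp (-(1 / 2 * (L : ℝ) ^ 2))) :=
        mul_le_mul_of_nonneg_left (pow_mul_exp_neg_sq_le' hd L) (by positivity)
    _ = 2 * (d : ℝ) ^ 2 * (L : ℝ) ^ (d - 2) * Real.exp (-(1 / 2 * (L : ℝ) ^ 2)) := by ring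

end TwistVortexBound

/-! ### Wilson-type actions `exp(β Re tr ρ(U_p))` at strong coupling: 't Hooft's twisted partition function -/

section WilsonType

variable {N : ℕ} [TopologicalSpace G] [IsTopologicalGroup G] [CompactSpace G] [MeasurableSpace G] [BorelSpace G]

omit [MeasurableSpace G] [BorelSpace G] in
/-- **`sup |e^{β Re tr ρ(U)} - 1| ≤ 2N|β|` for `N|β| ≤ 1`**: a Wilson-type weight of a continuous `N`-dimensional
representation of a compact group is uniformly close to `1` at strong coupling (`|Re tr ρ(U)| ≤ N` by unitarisability).
[cite: ItoSeiler2008Further, §2 Thm 2.2 (1)] -/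
theorem abs_exp_mul_re_trace_sub_one_le (ρ : G →* Matrix (Fin N) (Fin N) ℂ) (hρ : Continuous ρ) {β : ℝ}
    (hβ : (N : ℝ) * |β| ≤ 1) (U : G) : |Real.exp (β * ((ρ U).trace).re) - 1| ≤ 2 * N * |β| := by
  have htr : |((ρ U).trace).re| ≤ N := by
    have h := Literature.RepresentationTheory.CompactGroups.CompactGroup.abs_re_trace_le_card ρ hρ U
    simpa using h
  have hx : |β * ((ρ U).trace).re| ≤ N * |β| := by
    rw [abs_mul]
    nlinarith [abs_nonneg β, abs_nonneg ((ρ U).trace).re]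
  have hx1 : |β * ((ρ U).trace).re| ≤ 1 := hx.trans hβ
  calc |Real.exp (β * ((ρ U).trace).re) - 1|
      ≤ 2 * |β * ((ρ U).trace).re| := Real.abs_exp_sub_one_le hx1
    _ ≤ 2 * N * |β| := by linarith

omit [IsTopologicalGroup G] [CompactSpace G] in
/-- A Wilson-type weight of a continuous representation is measurable. [cite: ItoSeiler2007Tomboulis, §2 eq. (2.1a)] -/
theorem measurable_exp_mul_re_trace (ρ : G →* Matrix (Fin N) (Fin N) ℂ) (hρ : Continuous ρ) (β : ℝ) :
    Measurable fun U : G => Real.exp (β * ((ρ U).trace).re) := by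
  have hc : Continuous fun U : G => Real.exp (β * ((ρ U).trace).re) :=
    Real.continuous_exp.comp (continuous_const.mul (Complex.continuous_re.comp (hρ.matrix_trace)))
  exact hc.measurable

variable [NeZero L]

omit [TopologicalSpace G] [IsTopologicalGroup G] [CompactSpace G] [MeasurableSpace G] [BorelSpace G] in
/-- Pointwise form of the Wilson Gibbs factor with insertions: `exp(-β Σ_p (N - Re tr(t_p U_p))) =
e^{-Nβ#plaq} ∏_p exp(β Re tr(t_p U_p))` (plumbing). [folklore] -/
private theorem exp_neg_mul_sum_eq_pow_mul_prod' (β : ℝ) (t : Plaquette d L → ℝ) :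
    Real.exp (-(β * ∑ p : Plaquette d L, ((N : ℕ) - t p : ℝ))) =
      Real.exp (-(β * N)) ^ Fintype.card (Plaquette d L) * ∏ p : Plaquette d L, Real.exp (β * t p) := by
  rw [Finset.mul_sum, ← Finset.sum_neg_distrib, Real.exp_sum, ← Finset.card_univ, ← Finset.prod_const,
    ← Finset.prod_mul_distrib]
  refine Finset.prod_congr rfl fun p _ => ?_
  rw [← Real.exp_add]
  congr 1
  ring

/-- **'t Hooft's twisted partition function of a Wilson-type action is `e^{-Nβ#plaquettes} · Z^{(𝒱)}_{w_β}`** with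
`w_β = exp(β Re tr ρ(·))`, twist element `z` and twist set the stack `𝒱_{ij}` (`twistedPartitionFunction` of
`TwistedPartitionFunction.lean` vs `twistZ`). [cite: Tomboulis2007Confinement, §4 eqs. (4.1)–(4.3)] -/
theorem twistedPartitionFunction_eq_twistZ (ρ : G →* Matrix (Fin N) (Fin N) ℂ) (β : ℝ) (z : G) {i j : Fin d}
    (hij : i < j) :
    twistedPartitionFunction ρ β L z ⟨(i, j), hij⟩ =
      Real.exp (-(β * N)) ^ Fintype.card (Plaquette d L) *
        twistZ d L z (fun W => Real.exp (β * ((ρ W).trace).re)) (vortexSheet L i j hij) := by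
  unfold twistedPartitionFunction twistZ
  rw [← integral_const_mul]
  congr 1
  funext U
  rw [exp_neg_mul_sum_eq_pow_mul_prod']
  congr 1
  refine Finset.prod_congr rfl fun p _ => ?_
  have hmem : p ∈ vortexSheet L i j hij ↔ (p.2 = ⟨(i, j), hij⟩ ∧ p.1 i = 0 ∧ p.1 j = 0) := by
    simp [vortexSheet]
  by_cases hp : p.2 = ⟨(i, j), hij⟩ ∧ p.1 i = 0 ∧ p.1 j = 0
  · rw [if_pos hp, if_pos (hmem.2 hp)]
  · rw [if_neg hp, if_neg (fun h => hp (hmem.1 h)), one_mul]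

/-- The untwisted one: `Z_{β,L}(𝟙) = e^{-Nβ#plaquettes} · Z_{w_β}` (any nominal twist element on the empty twist set).
[cite: Tomboulis2007Confinement, §4 eqs. (4.1)–(4.3)] -/
theorem twistedPartitionFunction_one_eq_twistZ (ρ : G →* Matrix (Fin N) (Fin N) ℂ) (β : ℝ) (z : G) {i j : Fin d}
    (hij : i < j) :
    twistedPartitionFunction ρ β L 1 ⟨(i, j), hij⟩ =
      Real.exp (-(β * N)) ^ Fintype.card (Plaquette d L) *
        twistZ d L z (fun W => Real.exp (β * ((ρ W).trace).re)) ∅ := by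
  unfold twistedPartitionFunction twistZ
  rw [← integral_const_mul]
  congr 1
  funext U
  rw [exp_neg_mul_sum_eq_pow_mul_prod']
  congr 1
  refine Finset.prod_congr rfl fun p _ => ?_
  rw [ite_self, one_mul, if_neg (Finset.notMem_empty p)]

/-- **'t Hooft's vortex ratio of a Wilson-type action is the weight vortex ratio**:
`Z_{β,L}(z; q)/Z_{β,L}(𝟙; q) = Z^{(𝒱)}_{w_β}/Z_{w_β}`. [cite: Tomboulis2007Confinement, §6.1 eq. (6.1)] -/
theorem twistedPartitionFunction_div_eq_twistZ_div (ρ : G →* Matrix (Fin N) (Fin N) ℂ) (β : ℝ) (z : G) {i j : Fin d}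
    (hij : i < j) :
    twistedPartitionFunction ρ β L z ⟨(i, j), hij⟩ / twistedPartitionFunction ρ β L 1 ⟨(i, j), hij⟩ =
      twistZ d L z (fun W => Real.exp (β * ((ρ W).trace).re)) (vortexSheet L i j hij) /
        twistZ d L z (fun W => Real.exp (β * ((ρ W).trace).re)) ∅ := by
  rw [twistedPartitionFunction_eq_twistZ, twistedPartitionFunction_one_eq_twistZ ρ β z hij]
  have hpos : 0 < Real.exp (-(β * N)) ^ Fintype.card (Plaquette d L) := pow_pos (Real.exp_pos _) _
  rw [mul_div_mul_left _ _ hpos.ne']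

variable [SecondCountableTopology G]

/-- **Ito–Seiler 2008 Theorem 2.2 (1) for every second-countable compact gauge group with a central involution, symmetric
tori**: for a continuous `N`-dimensional representation `ρ`, Wilson's action `β Σ_p (N - Re tr ρ(U_p))`, a central `z` with
`z² = 1` and `|β| ≤ β₁(d, N) = 1/(4N (8(d-1)+1)² e²)`: on every torus `(ℤ/Lℤ)^d` and every plane `(i, j)`,
`1 - Z_{β,L}(z)/Z_{β,L}(𝟙) ≤ 2d² L^{d-2} e^{-L²/2}` ('t Hooft's electric-flux free energy obeys the area law with
`σ = 1/2`). The printed statement ("`G = U(1)` or `G = SU(2)` … for `β < β₁` … area decay law") is the pair of instances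
`z = -1 ∈ U(1)` (`u1_one_sub_twistedPartitionFunction_div_le` below) and `z = -𝟙 ∈ SU(2)` (`mainClaimTHooft_of_abs_le` of
`PlaquetteWeightVortexBound.lean`). TODO(general form): asymmetric tori `L₃L₄ → ∞`.
[cite: ItoSeiler2008Further, §2 Thm 2.2 (1)] [cite: Tomboulis2007Confinement, §6.2 eqs. (6.10)–(6.14)] -/
theorem one_sub_twistedPartitionFunction_div_le {z : G} (hzc : ∀ g : G, z * g = g * z) (hz2 : z * z = 1)
    (ρ : G →* Matrix (Fin N) (Fin N) ℂ) (hρ : Continuous ρ) {β : ℝ}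
    (hβ : |β| ≤ 1 / (4 * N * ((((8 * (d - 1) : ℕ) : ℝ) + 1) ^ 2 * Real.exp 2))) {i j : Fin d} (hij : i < j) :
    1 - twistedPartitionFunction ρ β L z ⟨(i, j), hij⟩ / twistedPartitionFunction ρ β L 1 ⟨(i, j), hij⟩ ≤
      2 * (d : ℝ) ^ 2 * (L : ℝ) ^ (d - 2) * Real.exp (-(1 / 2 * (L : ℝ) ^ 2)) := by
  have hK : (1 : ℝ) ≤ (((8 * (d - 1) : ℕ) : ℝ) + 1) ^ 2 * Real.exp 2 := by
    have hD : (1 : ℝ) ≤ (((8 * (d - 1) : ℕ) : ℝ) + 1) ^ 2 := by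
      have : (0 : ℝ) ≤ ((8 * (d - 1) : ℕ) : ℝ) := Nat.cast_nonneg _
      nlinarith
    have he : (1 : ℝ) ≤ Real.exp 2 := Real.one_le_exp (by norm_num)
    nlinarith
  -- the smallness of `ε = 2N|β|`
  have hNβ : (N : ℝ) * |β| * (4 * ((((8 * (d - 1) : ℕ) : ℝ) + 1) ^ 2 * Real.exp 2)) ≤ 1 := by
    rcases Nat.eq_zero_or_pos N with hN | hN
    · simp [hN]
    · have hNpos : (0 : ℝ) < N := by exact_mod_cast hN
      have hden : (0 : ℝ) < 4 * N * ((((8 * (d - 1) : ℕ) : ℝ) + 1) ^ 2 * Real.exp 2) := by positivity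
      have h := hβ
      rw [le_div_iff₀ hden] at h
      linarith
  have hNβ1 : (N : ℝ) * |β| ≤ 1 := by
    have : (N : ℝ) * |β| * 4 ≤ (N : ℝ) * |β| * (4 * ((((8 * (d - 1) : ℕ) : ℝ) + 1) ^ 2 * Real.exp 2)) := by
      have h0 : 0 ≤ (N : ℝ) * |β| := by positivity
      nlinarith
    linarith
  have hε : ∀ W : G, |Real.exp (β * ((ρ W).trace).re) - 1| ≤ 2 * N * |β| :=
    abs_exp_mul_re_trace_sub_one_le ρ hρ hNβ1
  have hsmall : (((8 * (d - 1) : ℕ) : ℝ) + 1) ^ 2 * (Real.exp 2 * (2 * N * |β|)) ≤ 1 / 2 := by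
    nlinarith [abs_nonneg β]
  rw [twistedPartitionFunction_div_eq_twistZ_div ρ β z hij]
  exact one_sub_twistZ_div_le hzc hz2 (measurable_exp_mul_re_trace ρ hρ β) hε hsmall hij

end WilsonType

/-! ### `G = U(1)`: Ito–Seiler 2008 Theorem 2.2 (1), first half, on symmetric tori -/

section U1

/-- **Ito–Seiler 2008 Theorem 2.2 (1) for `G = U(1)` on the symmetric tori** (arXiv:0803.3019 §2 Thm 2.2 (1) with Remark
2.1 (3): the twist is `U(p) ↦ -U(p)` on the stack, "`U_ω(p) = -U(p)` for `ω = π`"; Wilson's action `β Σ_p (1 - cos θ_p)` =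
`β Σ_p (1 - Re u1Rep(U_p))`): for `|β| ≤ β₁(d) = 1/(4 (8(d-1)+1)² e²)`, every torus `(ℤ/Lℤ)^d` and every plane,
`1 - Z⁻_{β,L}/Z_{β,L} ≤ 2d² L^{d-2} e^{-L²/2}`. (Part (2) of the theorem — deconfinement of `U(1)` at large `β`, Guth /
Fröhlich–Spencer — is the named fact `FrohlichSpencerU1PerimeterLawD4` elsewhere in the tree and is not touched here.)
[cite: ItoSeiler2008Further, §2 Thm 2.2 (1) and Remark 2.1 (3)] -/
theorem u1_one_sub_twistedPartitionFunction_div_le [MeasurableSpace Circle] [BorelSpace Circle] (d : ℕ) {β : ℝ}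
    (hβ : |β| ≤ 1 / (4 * ((((8 * (d - 1) : ℕ) : ℝ) + 1) ^ 2 * Real.exp 2))) {L : ℕ} [NeZero L] {i j : Fin d}
    (hij : i < j) :
    1 - twistedPartitionFunction u1Rep β L (-1) ⟨(i, j), hij⟩ / twistedPartitionFunction u1Rep β L 1 ⟨(i, j), hij⟩ ≤
      2 * (d : ℝ) ^ 2 * (L : ℝ) ^ (d - 2) * Real.exp (-(1 / 2 * (L : ℝ) ^ 2)) := by
  have hβ' : |β| ≤ 1 / (4 * (1 : ℕ) * ((((8 * (d - 1) : ℕ) : ℝ) + 1) ^ 2 * Real.exp 2)) := by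
    simpa using hβ
  exact one_sub_twistedPartitionFunction_div_le (fun g => by rw [mul_comm]) (by simp) u1Rep continuous_u1Rep hβ' hij

end U1

end CentralTwist

end Literature.MathematicalPhysics.QuantumFieldTheory

end
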